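import Summits.BirchSwinnertonDyer.BirchSwinnertonDyer.Theorems.ByReductionTypeAtTwoSupersingularFlatColemanClauses
import Literature.NumberTheory.EllipticCurves.Sprung2012.ColemanTwistProofs
import Literature.NumberTheory.EllipticCurves.Sprung2017.ChromaticLimitCongruenceProofs
import HarnessLib

/-!
# `Ker Col♭` is `Γ`-TWIST-SATURATED and CLOSED in the finite topology of `Hom(E(K_∞·K_v), ℤ_p)` — the two
# algebraic inputs of «`(E♭_{∞,𝔭})_Γ = 0`», i.e. of the ♭-local lift LOC♭ at the place above `p`
# (any `p`, EXPLICIT Honda clauses; the `p = 2` port)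

Seat `bsd-2adic-ss-1` GEN 13, crux `SupersingularRankZeroAtTwo` (item stmt-BirchSwinnertonDyer-19097, route
`ByReductionTypeAtTwo`, rung K4), line `flat_uniform_two` v1, stub (2) `stub_allFlatData`, conjunct COUNT♭@2 —
part 16: the KERNEL road for the last displayed input `hloc2` (LOC♭) of the door
`SSFlatEC.flatCountTwo_of_print_of_loc2` (part 15). LOC♭ = «`H¹(ℚ₂, E[2^∞]) ↠ (H¹(ℚ_{2,∞}, E[2^∞])/E♭_∞)^Γ`»
= `cd_2 Γ = 1` + «`(E♭_∞)_Γ = 0`»; and `(E♭_∞)_Γ = 0` is, by Pontryagin duality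
(`(E♭_∞)^∨ = H¹_Iw/Ker Col♭ ↪ Λ` a domain), the conjunction of the two statements PROVED HERE about
`K := Ker Col♭ ⊆ 𝓗 := Hom(E(K_∞·K_v), ℤ_p)` (Sprung 2012 Def. 7.9, tree `Sprung2012.colemanKer … .flat`):

* §1 **twist-saturation** (`mem_colemanKer_flat_of_twist_sub_mem`, with `mem_colemanKer_flat_twist_iff`):
  `z ∘ g⁻¹ − z ∈ K ⇒ z ∈ K` — from `Col(z ∘ g⁻¹ − z) = T·Col(z)` (`Sprung2012.IsColemanPair.twist_sub`),
  uniqueness of Coleman values (`IsColemanPair.unique`, Prop. 5.7, `p ∣ a_p`) and `T ≠ 0` in `Λ`;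
  dually: `((E♭_∞)^∨)^Γ = Λ^{(1+T) = 1} = 0`;
* §2 **continuity of `Col♭`** (`pow_dvd_coeff_flat_of_dvd_evalOn`): if `p^k ∣ z(gʲc_m)` for `m ∈ {n, n+1}`,
  `j < p^m`, then `p^{min(k, ⌊n/2⌋ − i)} ∣ Col♭(z)_i` — `Sprung2017.IsChromaticLimit.pow_dvd_coeff_flat` on
  the queue sequence `(P_{m,c_m}(z))_m`;
* §3 **closedness** (`mem_colemanKer_flat_of_forall_exists_agree`): if for every `n, k` some `z' ∈ K`
  agrees with `z` modulo `p^k` on `{gʲ c_m : m ∈ {n, n+1}, j < p^m}`, then `z ∈ K` — so `K = K̄` in the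
  topology of pointwise convergence, the input of the biduality `K^⊥⊥ = K` for the local Tate pairing.
Hypotheses (as in parts 1–3 of the `p = 2` port): `p ∣ a_p`, a local `g` restricting to a topological
generator, levels `c_n ∈ E(K_n·K_v)`, the `n ≥ 1` trace relation — nothing else (no surjectivity, no
torsion hypothesis). Any number field `K`, any completion, any `p`.
HONEST FRAMING: kernel algebra on the tree's transcription of Sprung's Coleman map; nothing about any curve
is asserted; no census cell moves; BSD is not proved by any of this. What this is NOT: not yet
`(E♭_∞)_Γ = 0` (needs the finite-topology biduality `K^⊥⊥ = K̄` and the evaluation form of the characters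
of `E(K_∞·K_v) ⊗ ℚ_p/ℤ_p` — parts 17+), not LOC♭ (needs in addition `cd_p Γ_𝔭 = 1` locally).

References: [Sprung2012] F. Sprung, J. Number Theory 132 (2012), Def. 3.1, Prop. 5.7, Lemma 5.8, Def. 5.9,
Def. 7.1, Def. 7.9 (pp. 1489–1503); [Sprung2017] ANT 11 (2017) Thm. 1.12, Cor. 4.4; [GreenbergLNM1716]
§4 proof of Lemma 4.7 p. 108 («the maps … for `v ∣ p`», `cd_p Γ = 1`).
-/

set_option autoImplicit false
-- the Theorems namespace of this sub repeats the summit name by design (D-0017 nested layout)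
set_option linter.dupNamespace false

noncomputable section

open scoped Classical NumberField

open NumberField IsDedekindDomain Polynomial WeierstrassCurve Literature.NumberTheory.EllipticCurves
  Literature.NumberTheory.GaloisRepresentations Literature.NumberTheory.EllipticCurves.ZpExtension
  Literature.NumberTheory.EllipticCurves.Kobayashi2003 Literature.NumberTheory.EllipticCurves.Sprung2017
  Literature.NumberTheory.EllipticCurves.Sprung2012

universe u

namespace Summit.BirchSwinnertonDyer.BirchSwinnertonDyer.Theorems.SSFlatEC

variable {K : Type u} [Field K] {p : ℕ} [Fact p.Prime] (κ : ZpExtension K p)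
variable {E : Type u} [Field E] [Algebra K E] (ι : AlgebraicClosure K →ₐ[K] AlgebraicClosure E)
variable (W : WeierstrassCurve K)

/-! ## §1 `Ker Col♭` is twist-saturated: `z ∘ g⁻¹ − z ∈ Ker Col♭ ⇒ z ∈ Ker Col♭` -/

/-- **Twist-saturation of `Ker Col♭`.** If the twisted difference `z ∘ g⁻¹ − z` ("`(γ−1)·z`") lies in
`Ker Col♭`, so does `z`: `Col(z ∘ g⁻¹ − z) = T·Col(z)` (`IsColemanPair.twist_sub`), Coleman values are unique
(Prop. 5.7, `p ∣ a_p`), and `T·Col♭(z) = 0` forces `Col♭(z) = 0` in the domain `Λ`. Dually this is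
`((E♭_∞)^∨)^Γ = 0`, i.e. `(E♭_∞)_Γ = 0` granted biduality.
[cite: Sprung2012, Def. 5.9, Prop. 5.7 (pp. 1494–1495), Def. 7.9 (p. 1503), §2 p. 1486 (T = γ − 1)] -/
theorem mem_colemanKer_flat_of_twist_sub_mem {ap : ℤ} (hap : (p : ℤ) ∣ ap)
    {g : Field.absoluteGaloisGroup E} (hg : κ.IsTopGenerator (resGalOfEmb ι g))
    {c : ℕ → localPoints W E} (hc : ∀ n, c n ∈ localLayerPointsOfEmb κ ι W n)
    (hTr : ∀ n, 1 ≤ n → localTraceOfEmb κ ι W n (n + 1) (c (n + 1)) = ap • c n - c (n - 1))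
    {z z' : localTowerPointsOfEmb κ ι W →+ ℤ_[p]}
    (hz' : ∀ y : localTowerPointsOfEmb κ ι W,
      z' y = z ⟨g⁻¹ • (y : localPoints W E), smul_mem_localTowerPointsOfEmb κ ι W g⁻¹ y.2⟩)
    (h : z' - z ∈ colemanKer κ ι W ap g c .flat) : z ∈ colemanKer κ ι W ap g c .flat := by
  obtain ⟨Ls, Lf, hz⟩ := exists_isColemanPair_of_trace κ ι W hg hap hc hTr z
  obtain ⟨a, b, hab, hb⟩ := h
  rw [chromaticL_flat] at hb
  obtain ⟨-, h2⟩ := (hz.twist_sub κ ι W hg hc hz').unique κ ι W hap hab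
  rw [hb, mul_eq_zero] at h2
  have hLf : Lf = 0 := h2.resolve_left PowerSeries.X_ne_zero
  exact ⟨Ls, Lf, hz, by rw [chromaticL_flat, hLf]⟩

/-- **`Ker Col♭` is twist-stable**: `z ∈ Ker Col♭ ↔ z ∘ g⁻¹ ∈ Ker Col♭` (`Col(z ∘ g⁻¹) = (1+T)·Col(z)`,
`IsColemanPair.twist`, and `1 + T ≠ 0`). [cite: Sprung2012, Def. 5.9 (p. 1495) and §2 p. 1486 (γ ↦ 1 + X)] -/
theorem mem_colemanKer_flat_twist_iff {ap : ℤ} (hap : (p : ℤ) ∣ ap)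
    {g : Field.absoluteGaloisGroup E} (hg : κ.IsTopGenerator (resGalOfEmb ι g))
    {c : ℕ → localPoints W E} (hc : ∀ n, c n ∈ localLayerPointsOfEmb κ ι W n)
    (hTr : ∀ n, 1 ≤ n → localTraceOfEmb κ ι W n (n + 1) (c (n + 1)) = ap • c n - c (n - 1))
    {z z' : localTowerPointsOfEmb κ ι W →+ ℤ_[p]}
    (hz' : ∀ y : localTowerPointsOfEmb κ ι W,
      z' y = z ⟨g⁻¹ • (y : localPoints W E), smul_mem_localTowerPointsOfEmb κ ι W g⁻¹ y.2⟩) :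
    z' ∈ colemanKer κ ι W ap g c .flat ↔ z ∈ colemanKer κ ι W ap g c .flat := by
  obtain ⟨Ls, Lf, hz⟩ := exists_isColemanPair_of_trace κ ι W hg hap hc hTr z
  have htw := hz.twist κ ι W hg hc hz'
  constructor
  · rintro ⟨a, b, hab, hb⟩
    rw [chromaticL_flat] at hb
    obtain ⟨-, h2⟩ := htw.unique κ ι W hap hab
    rw [hb, mul_eq_zero] at h2
    have h1X : (1 + PowerSeries.X : IwasawaAlgebra p) ≠ 0 := by
      intro h0
      have := congrArg PowerSeries.constantCoeff h0
      rw [map_add, map_one, PowerSeries.constantCoeff_X, add_zero, map_zero] at this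
      exact one_ne_zero this
    have hLf : Lf = 0 := h2.resolve_left h1X
    exact ⟨Ls, Lf, hz, by rw [chromaticL_flat, hLf]⟩
  · rintro ⟨a, b, hab, hb⟩
    rw [chromaticL_flat] at hb
    obtain ⟨-, h2⟩ := hz.unique κ ι W hap hab
    refine ⟨(1 + PowerSeries.X) * Ls, (1 + PowerSeries.X) * Lf, htw, ?_⟩
    rw [chromaticL_flat, h2, hb, mul_zero]

/-! ## §2 Continuity of `Col♭` at a functional small on two consecutive levels -/

/-- If `p^k ∣ z(gʲ c_n)` for all `j < pⁿ` then `p^k ∣ Θ_n(z) = P_{n,c_n}(z)` in `ℤ_p[T]`.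
[cite: Sprung2012, Def. 3.1 (p. 1489)] -/
theorem C_pow_dvd_colemanTheta_of_dvd_evalOn (g : Field.absoluteGaloisGroup E) (c : ℕ → localPoints W E)
    (z : localTowerPointsOfEmb κ ι W →+ ℤ_[p]) {n k : ℕ}
    (h : ∀ j < p ^ n, (p : ℤ_[p]) ^ k ∣ evalOn W (localTowerPointsOfEmb κ ι W) z (g ^ j • c n)) :
    Polynomial.C ((p : ℤ_[p]) ^ k) ∣ colemanTheta κ ι W g c z n := by
  rw [Polynomial.C_dvd_iff_dvd_coeff]
  intro i
  rw [colemanTheta, Polynomial.finsetSum_coeff]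
  refine Finset.dvd_sum fun j hj ↦ ?_
  rw [Polynomial.coeff_C_mul]
  exact (h j (Finset.mem_range.mp hj)).mul_right _

/-- **Continuity of `Col♭` (and `Col♯`).** For a functional `z` with Coleman value `(L♯, L♭)`: if
`p^k ∣ z(gʲ c_m)` for `m ∈ {n, n+1}` and all `j < p^m`, then `p^{min(k, ⌊n/2⌋ − i)}` divides the `i`-th
coefficient of `L♭` and of `L♯` — `Sprung2017.IsChromaticLimit.pow_dvd_coeff_flat/_sharp` for the queue
sequence `Θ_m = P_{m,c_m}(z)`. [cite: Sprung2012, Prop. 5.7 and Lemma 5.8 (pp. 1494–1495), Def. 5.9]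
[cite: Sprung2017, Thm. 1.12] -/
theorem pow_dvd_coeff_flat_of_dvd_evalOn {ap : ℤ} (hap : (p : ℤ) ∣ ap) {g : Field.absoluteGaloisGroup E}
    {c : ℕ → localPoints W E} {z : localTowerPointsOfEmb κ ι W →+ ℤ_[p]} {Ls Lf : IwasawaAlgebra p}
    (hz : IsColemanPair κ ι W ap g c z Ls Lf) {n k : ℕ}
    (h : ∀ m, m = n ∨ m = n + 1 → ∀ j < p ^ m,
      (p : ℤ_[p]) ^ k ∣ evalOn W (localTowerPointsOfEmb κ ι W) z (g ^ j • c m)) (i : ℕ) :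
    (p : ℤ_[p]) ^ min k (n / 2 - i) ∣ PowerSeries.coeff i Lf ∧
      (p : ℤ_[p]) ^ min k (n / 2 - i) ∣ PowerSeries.coeff i Ls := by
  have hlim := isChromaticLimit_of_isColemanPair κ ι W hz
  obtain ⟨A, hA⟩ := C_pow_dvd_colemanTheta_of_dvd_evalOn κ ι W g c z (h n (Or.inl rfl))
  obtain ⟨B, hB⟩ := C_pow_dvd_colemanTheta_of_dvd_evalOn κ ι W g c z (h (n + 1) (Or.inr rfl))
  exact ⟨hlim.pow_dvd_coeff_flat hap hA hB i, hlim.pow_dvd_coeff_sharp hap hA hB i⟩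

/-! ## §3 `Ker Col♭` is closed in the finite topology -/

/-- **`Ker Col♭` is CLOSED.** Let `z` be a functional on `E(K_∞·K_v)` such that for every `n, k` there is
`z' ∈ Ker Col♭` with `z ≡ z'` modulo `p^k` on the finite set `{gʲ c_m : m ∈ {n, n+1}, j < p^m}`. Then
`z ∈ Ker Col♭`: `z − z'` has Coleman value `(L♯ − L♯', L♭)` (`IsColemanPair.sub`, `L♭' = 0`), so by §2
`p^{min(k, ⌊n/2⌋ − i)} ∣ (L♭)_i`; with `n = 2(i + k)` every coefficient of `L♭` is divisible by every
`p^k`, hence `L♭ = 0`. [cite: Sprung2012, Prop. 5.7 and Lemma 5.8 («⋂ M_n = 0», pp. 1494–1495), Def. 7.9 (p. 1503)] -/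
theorem mem_colemanKer_flat_of_forall_exists_agree {ap : ℤ} (hap : (p : ℤ) ∣ ap)
    {g : Field.absoluteGaloisGroup E} (hg : κ.IsTopGenerator (resGalOfEmb ι g))
    {c : ℕ → localPoints W E} (hc : ∀ n, c n ∈ localLayerPointsOfEmb κ ι W n)
    (hTr : ∀ n, 1 ≤ n → localTraceOfEmb κ ι W n (n + 1) (c (n + 1)) = ap • c n - c (n - 1))
    (z : localTowerPointsOfEmb κ ι W →+ ℤ_[p])
    (h : ∀ n k : ℕ, ∃ z' ∈ colemanKer κ ι W ap g c .flat, ∀ m, m = n ∨ m = n + 1 → ∀ j < p ^ m,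
      (p : ℤ_[p]) ^ k ∣ evalOn W (localTowerPointsOfEmb κ ι W) z (g ^ j • c m) -
        evalOn W (localTowerPointsOfEmb κ ι W) z' (g ^ j • c m)) :
    z ∈ colemanKer κ ι W ap g c .flat := by
  obtain ⟨Ls, Lf, hz⟩ := exists_isColemanPair_of_trace κ ι W hg hap hc hTr z
  suffices hLf : Lf = 0 from ⟨Ls, Lf, hz, by rw [chromaticL_flat, hLf]⟩
  ext i
  rw [map_zero]
  refine padicInt_eq_zero_of_forall_pow_dvd fun k ↦ ?_
  obtain ⟨z', ⟨Ls', Lf', hz', hLf'⟩, hag⟩ := h (2 * (i + k)) k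
  rw [chromaticL_flat] at hLf'
  have hmem : ∀ (m j : ℕ), g ^ j • c m ∈ localTowerPointsOfEmb κ ι W := fun m j ↦
    smul_mem_localTowerPointsOfEmb κ ι W _ (localLayerPointsOfEmb_le_localTowerPointsOfEmb κ ι W m (hc m))
  have hsub : ∀ m, m = 2 * (i + k) ∨ m = 2 * (i + k) + 1 → ∀ j < p ^ m,
      (p : ℤ_[p]) ^ k ∣ evalOn W (localTowerPointsOfEmb κ ι W) (z - z') (g ^ j • c m) := by
    intro m hm j hj
    rw [evalOn_of_mem W _ _ (hmem m j), AddMonoidHom.sub_apply, ← evalOn_of_mem W _ z (hmem m j),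
      ← evalOn_of_mem W _ z' (hmem m j)]
    exact hag m hm j hj
  have hk := (pow_dvd_coeff_flat_of_dvd_evalOn κ ι W hap (hz.sub hz') hsub i).1
  rwa [hLf', sub_zero, show 2 * (i + k) / 2 - i = k by omega, min_self] at hk

end Summit.BirchSwinnertonDyer.BirchSwinnertonDyer.Theorems.SSFlatEC

end
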